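import Summits.CriticalPhenomena.Ising3DConformalLimit.Theorems.PerfectScreeningGaussianLimitNotScreenedRieszBalayage
import Mathlib.Analysis.SpecialFunctions.JapaneseBracket
import HarnessLib

/-!
# Positive semi-definiteness of the Riesz kernel `|v - w|^{-2Δ}` on `ℝ²` (stub C1)

Stub `stub_rieszKernelPosDef` (C1) of line `single-layer-linear-regression` for the crux
`GaussianLimitNotScreened` (stmt-CriticalPhenomena-13886): for `1/2 ≤ Δ < 1`, a compactly
supported continuous `φ` and a continuous `ψ` with `|ψ(w)| ≤ C (1+|w|²)^{Δ-2}` on `ℝ²`, the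
completed-square form `2⟨φ, Kψ⟩ ≤ ⟨φ, Kφ⟩ + ⟨ψ, Kψ⟩` of positivity of the Riesz energy,
`K(v, w) = |v - w|^{-2Δ}` (iterated Bochner integrals).

Proof (M. Riesz; Bochner–Schoenberg, done with Gaussians): by Gaussian subordination
`|z|^{-2Δ} = Γ(Δ)⁻¹ ∫₀^∞ t^{Δ-1} e^{-t|z|²} dt` and the semigroup identity
`e^{-t|v-w|²} = (4t/π) ∫ e^{-2t|v-z|²} e^{-2t|w-z|²} dz`, the energy of `f = φ - ψ` is
`⟨f, Kf⟩ = (4/(π Γ(Δ))) ∫₀^∞ ∫ t^Δ (∫ f(x) e^{-2t|x-z|²} dx)² dz dt ≥ 0`.  All exchanges of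
integrals are justified by the absolute convergence of `∫∫ |h(v)| |g(w)| K` (uniform potential
bound `∫ |g(w)| |v-w|^{-2Δ} dw ≤ (‖g‖₁ + π‖g‖_∞) Γ(1-Δ)`, by subordination and a Beta integral);
bilinearity and the symmetry `⟨ψ, Kφ⟩ = ⟨φ, Kψ⟩` then give the claim.
-/

namespace Summit.CriticalPhenomena.Ising3DConformalLimit.Cruxes.GaussianLimitNotScreened.SingleLayerLinearRegression

open MeasureTheory Filter Topology Real Set Function Literature.Analysis.UnboundedOperators
open scoped ENNReal

/-- Gaussian subordination of the Riesz kernel: for `w ≠ v` and `0 < Δ`,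
`|v-w|^{-2Δ} = Γ(Δ)⁻¹ ∫₀^∞ t^{Δ-1} e^{-t|v-w|²} dt`, in `ℝ≥0∞`. [folklore] -/
theorem rieszPosDef_kernel_eq_lintegral {Δ : ℝ} (hΔ0 : 0 < Δ) {v w : EuclideanSpace ℝ (Fin 2)}
    (hw : w ≠ v) : ENNReal.ofReal (‖v - w‖ ^ (-(2 * Δ))) = ENNReal.ofReal (Real.Gamma Δ)⁻¹ *
      ∫⁻ t in Ioi (0:ℝ), ENNReal.ofReal (t ^ (Δ - 1) * rexp (-(‖v - w‖ ^ 2 * t))) := by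
  have hc : 0 < ‖v - w‖ := norm_sub_pos_iff.2 hw.symm
  have hΓ : 0 < Real.Gamma Δ := Real.Gamma_pos_of_pos hΔ0
  rw [rieszBalayage_lintegral_rpow_mul_exp hΔ0 (by positivity : (0:ℝ) < ‖v - w‖ ^ 2),
    ← ENNReal.ofReal_mul (inv_nonneg.2 hΓ.le)]
  congr 1
  have e : (‖v - w‖ ^ 2) ^ Δ = ‖v - w‖ ^ (2 * Δ) := by
    rw [← Real.rpow_natCast, ← Real.rpow_mul hc.le]; norm_num
  rw [one_div, Real.inv_rpow (by positivity), e, Real.rpow_neg hc.le]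
  field_simp

/-- A uniform bound for the Riesz potential of a bounded integrable density on `ℝ²`:
`∫ |g(w)| |v-w|^{-2Δ} dw ≤ (‖g‖₁ + M π) Γ(1-Δ)` for all `v` (`0 < Δ < 1`, `|g| ≤ M`), by
Gaussian subordination, `∫ |g| e^{-t|v-·|²} ≤ min (‖g‖₁, Mπ/t) ≤ (‖g‖₁ + Mπ)/(1+t)` and the Beta
integral `∫₀^∞ t^{Δ-1}/(1+t) dt = Γ(Δ)Γ(1-Δ)`. [folklore] -/
theorem rieszPosDef_lintegral_potential_le {Δ : ℝ} (hΔ0 : 0 < Δ) (hΔ1 : Δ < 1)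
    {g : EuclideanSpace ℝ (Fin 2) → ℝ} (hg : Continuous g) (hgi : Integrable g) {M : ℝ}
    (hM : ∀ w, |g w| ≤ M) (v : EuclideanSpace ℝ (Fin 2)) :
    ∫⁻ w, ‖g w‖ₑ * ENNReal.ofReal (‖v - w‖ ^ (-(2 * Δ))) ≤
      ENNReal.ofReal (((∫ w, |g w|) + M * π) * Real.Gamma (1 - Δ)) := by
  have hM0 : 0 ≤ M := (abs_nonneg _).trans (hM 0)
  have hΓ : 0 < Real.Gamma Δ := Real.Gamma_pos_of_pos hΔ0
  have ha0 : 0 ≤ ∫ w, |g w| := integral_nonneg fun w => abs_nonneg _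
  have ha : ∫⁻ w, ‖g w‖ₑ = ENNReal.ofReal (∫ w, |g w|) := by
    rw [← ofReal_integral_norm_eq_lintegral_enorm hgi]; rfl
  -- (i) subordination, almost everywhere (off `w = v`), and Tonelli
  have h_ae : ∀ᵐ w, ‖g w‖ₑ * ENNReal.ofReal (‖v - w‖ ^ (-(2 * Δ))) =
      ENNReal.ofReal (Real.Gamma Δ)⁻¹ * ∫⁻ t in Ioi (0:ℝ),
        ‖g w‖ₑ * ENNReal.ofReal (t ^ (Δ - 1) * rexp (-(‖v - w‖ ^ 2 * t))) := by
    filter_upwards [measure_eq_zero_iff_ae_notMem.1 (measure_singleton (μ := volume) v)]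
      with w hw
    rw [rieszPosDef_kernel_eq_lintegral hΔ0 (by simpa using hw),
      lintegral_const_mul' _ _ enorm_ne_top, mul_left_comm]
  rw [lintegral_congr_ae h_ae, lintegral_const_mul' _ _ ENNReal.ofReal_ne_top,
    lintegral_lintegral_swap (by fun_prop)]
  -- (ii) the bound on the Gaussian potential, for every `t > 0`
  have hbound : ∀ t ∈ Ioi (0:ℝ),
      ∫⁻ w, ‖g w‖ₑ * ENNReal.ofReal (t ^ (Δ - 1) * rexp (-(‖v - w‖ ^ 2 * t))) ≤
        ENNReal.ofReal (t ^ (Δ - 1) / (1 + 1 * t)) * ENNReal.ofReal ((∫ w, |g w|) + M * π) := by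
    intro t ht
    have ht : (0:ℝ) < t := ht
    have h0 : 0 ≤ t ^ (Δ - 1) := by positivity
    -- two bounds: drop the Gaussian, or drop `g`
    have h1 : ∫⁻ w, ‖g w‖ₑ * ENNReal.ofReal (t ^ (Δ - 1) * rexp (-(‖v - w‖ ^ 2 * t))) ≤
        ENNReal.ofReal (t ^ (Δ - 1) * ∫ w, |g w|) := by
      calc _ ≤ ∫⁻ w, ‖g w‖ₑ * ENNReal.ofReal (t ^ (Δ - 1)) := by
            refine lintegral_mono fun w => ?_
            gcongr
            exact mul_le_of_le_one_right h0
              (Real.exp_le_one_iff.2 (by nlinarith [sq_nonneg ‖v - w‖]))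
        _ = ENNReal.ofReal (t ^ (Δ - 1) * ∫ w, |g w|) := by
            rw [lintegral_mul_const' _ _ ENNReal.ofReal_ne_top, ha, ← ENNReal.ofReal_mul ha0,
              mul_comm]
    have h2 : ∫⁻ w, ‖g w‖ₑ * ENNReal.ofReal (t ^ (Δ - 1) * rexp (-(‖v - w‖ ^ 2 * t))) ≤
        ENNReal.ofReal (t ^ (Δ - 1) * (M * π / t)) := by
      calc _ ≤ ∫⁻ w, ENNReal.ofReal (M * t ^ (Δ - 1)) *
              ENNReal.ofReal (rexp (-t * ‖w - v‖ ^ 2)) := by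
            refine lintegral_mono fun w => ?_
            rw [Real.enorm_eq_ofReal_abs, ← ENNReal.ofReal_mul (abs_nonneg _),
              ← ENNReal.ofReal_mul (by positivity)]
            refine ENNReal.ofReal_le_ofReal ?_
            rw [norm_sub_rev, show -(‖w - v‖ ^ 2 * t) = -t * ‖w - v‖ ^ 2 by ring, ← mul_assoc]
            gcongr
            exact hM w
        _ = ENNReal.ofReal (t ^ (Δ - 1) * (M * π / t)) := by
            rw [lintegral_const_mul' _ _ ENNReal.ofReal_ne_top, lintegral_sub_right_eq_self
                (fun y : EuclideanSpace ℝ (Fin 2) => ENNReal.ofReal (rexp (-t * ‖y‖ ^ 2))) v,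
              rieszBalayage_lintegral_gauss ht, ← ENNReal.ofReal_mul (by positivity)]
            congr 1
            field_simp
    -- combine: `min (a, b/t) ≤ (a + b)/(1 + t)`
    have h3 : ∫⁻ w, ‖g w‖ₑ * ENNReal.ofReal (t ^ (Δ - 1) * rexp (-(‖v - w‖ ^ 2 * t))) ≤
        ENNReal.ofReal (t ^ (Δ - 1) * min (∫ w, |g w|) (M * π / t)) := by
      rcases min_choice (∫ w, |g w|) (M * π / t) with h | h <;> rw [h]
      exacts [h1, h2]
    refine h3.trans ?_
    rw [← ENNReal.ofReal_mul (by positivity)]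
    refine ENNReal.ofReal_le_ofReal ?_
    rw [one_mul, div_mul_eq_mul_div, le_div_iff₀ (by positivity)]
    have key : min (∫ w, |g w|) (M * π / t) * (1 + t) ≤ (∫ w, |g w|) + M * π := by
      rcases le_total (∫ w, |g w|) (M * π / t) with h | h
      · rw [min_eq_left h]
        have := (le_div_iff₀ ht).1 h
        nlinarith
      · rw [min_eq_right h]
        have e : M * π / t * (1 + t) = M * π / t + M * π := by field_simp
        rw [e]; linarith
    nlinarith
  -- (iii) integrate the bound in `t` (Beta integral)
  calc _ ≤ ENNReal.ofReal (Real.Gamma Δ)⁻¹ * ∫⁻ t in Ioi (0:ℝ),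
          ENNReal.ofReal (t ^ (Δ - 1) / (1 + 1 * t)) * ENNReal.ofReal ((∫ w, |g w|) + M * π) :=
        mul_le_mul_right (lintegral_mono_ae ((ae_restrict_mem measurableSet_Ioi).mono hbound)) _
    _ = ENNReal.ofReal (((∫ w, |g w|) + M * π) * Real.Gamma (1 - Δ)) := by
        rw [lintegral_mul_const' _ _ ENNReal.ofReal_ne_top,
          rieszBalayage_lintegral_beta hΔ0 hΔ1 one_pos, ← ENNReal.ofReal_mul (by positivity),
          ← ENNReal.ofReal_mul (by positivity)]
        congr 1
        rw [Real.one_rpow]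
        field_simp

/-- For continuous integrable `h` and continuous integrable bounded `g` on `ℝ²` and `0 < Δ < 1`,
the Riesz-energy integrand `(v, w) ↦ h(v) g(w) |v-w|^{-2Δ}` is integrable on `ℝ² × ℝ²`
(Tonelli and the uniform potential bound). [folklore] -/
theorem rieszPosDef_integrable_prod {Δ : ℝ} (hΔ0 : 0 < Δ) (hΔ1 : Δ < 1)
    {h g : EuclideanSpace ℝ (Fin 2) → ℝ} (hh : Continuous h) (hg : Continuous g)
    (hhi : Integrable h) (hgi : Integrable g) {M : ℝ} (hM : ∀ w, |g w| ≤ M) :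
    Integrable (fun p : EuclideanSpace ℝ (Fin 2) × EuclideanSpace ℝ (Fin 2) =>
      h p.1 * g p.2 * ‖p.1 - p.2‖ ^ (-(2 * Δ))) := by
  have hm : Measurable (fun p : EuclideanSpace ℝ (Fin 2) × EuclideanSpace ℝ (Fin 2) =>
      h p.1 * g p.2 * ‖p.1 - p.2‖ ^ (-(2 * Δ))) :=
    ((hh.measurable.comp measurable_fst).mul (hg.measurable.comp measurable_snd)).mul
      ((measurable_fst.sub measurable_snd).norm.pow_const _)
  refine ⟨hm.aestronglyMeasurable, ?_⟩
  rw [hasFiniteIntegral_iff_enorm, Measure.volume_eq_prod, lintegral_prod _ hm.enorm.aemeasurable]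
  have e : ∀ v w : EuclideanSpace ℝ (Fin 2), ‖h v * g w * ‖v - w‖ ^ (-(2 * Δ))‖ₑ =
      ‖h v‖ₑ * (‖g w‖ₑ * ENNReal.ofReal (‖v - w‖ ^ (-(2 * Δ)))) := by
    intro v w
    rw [enorm_mul, enorm_mul, Real.enorm_eq_ofReal (by positivity : (0:ℝ) ≤ ‖v - w‖ ^ (-(2 * Δ))),
      mul_assoc]
  simp only [e]
  calc _ = ∫⁻ v, ‖h v‖ₑ * ∫⁻ w, ‖g w‖ₑ * ENNReal.ofReal (‖v - w‖ ^ (-(2 * Δ))) :=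
        lintegral_congr fun v => lintegral_const_mul' _ _ enorm_ne_top
    _ ≤ ∫⁻ v, ‖h v‖ₑ * ENNReal.ofReal (((∫ w, |g w|) + M * π) * Real.Gamma (1 - Δ)) :=
        lintegral_mono fun v =>
          mul_le_mul_right (rieszPosDef_lintegral_potential_le hΔ0 hΔ1 hg hgi hM v) _
    _ = (∫⁻ v, ‖h v‖ₑ) * ENNReal.ofReal (((∫ w, |g w|) + M * π) * Real.Gamma (1 - Δ)) :=
        lintegral_mul_const' _ _ ENNReal.ofReal_ne_top
    _ < ∞ := ENNReal.mul_lt_top hhi.2 ENNReal.ofReal_lt_top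

/-- The diagonal of `ℝ² × ℝ²` is Lebesgue-null: `v ≠ w` for almost every pair. [folklore] -/
theorem rieszPosDef_ae_ne :
    ∀ᵐ p : EuclideanSpace ℝ (Fin 2) × EuclideanSpace ℝ (Fin 2), p.1 ≠ p.2 := by
  have h : (volume : Measure (EuclideanSpace ℝ (Fin 2) × EuclideanSpace ℝ (Fin 2)))
      (diagonal (EuclideanSpace ℝ (Fin 2))) = 0 := by
    rw [Measure.volume_eq_prod, Measure.prod_apply measurableSet_diagonal]
    have : ∀ x : EuclideanSpace ℝ (Fin 2),
        Prod.mk x ⁻¹' diagonal (EuclideanSpace ℝ (Fin 2)) = {x} := fun x => by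
      ext y; simp [eq_comm]
    simp [this]
  rw [ae_iff]
  simpa [diagonal] using h

/-- The Riesz kernel as a superposition of Gaussian convolution squares: for `v ≠ w` and
`0 < Δ`, `∫₀^∞ ∫ t^Δ e^{-2t|v-z|²} e^{-2t|w-z|²} dz dt = (π Γ(Δ)/4) |v-w|^{-2Δ}` in `ℝ≥0∞`
(the `z`-integral is `(π/4t) e^{-t|v-w|²}` by the Gaussian semigroup identity, the
`t`-integral is Euler's; we write `|t|^Δ` to keep the integrand non-negative). [folklore] -/
theorem rieszPosDef_lintegral_gaussPair {Δ : ℝ} (hΔ0 : 0 < Δ) {v w : EuclideanSpace ℝ (Fin 2)}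
    (hw : v ≠ w) : ∫⁻ q, ENNReal.ofReal (|q.1| ^ Δ *
        (rexp (-(2 * q.1) * ‖v - q.2‖ ^ 2) * rexp (-(2 * q.1) * ‖w - q.2‖ ^ 2)))
        ∂((volume : Measure ℝ).restrict (Ioi 0)).prod volume =
      ENNReal.ofReal (π / 4 * Real.Gamma Δ * ‖v - w‖ ^ (-(2 * Δ))) := by
  have hc : 0 < ‖v - w‖ := norm_sub_pos_iff.2 hw
  rw [lintegral_prod _ (by fun_prop)]
  have h1 : ∀ t ∈ Ioi (0:ℝ), ∫⁻ z, ENNReal.ofReal (|t| ^ Δ *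
      (rexp (-(2 * t) * ‖v - z‖ ^ 2) * rexp (-(2 * t) * ‖w - z‖ ^ 2))) =
        ENNReal.ofReal (π / 4) * ENNReal.ofReal (t ^ (Δ - 1) * rexp (-(‖v - w‖ ^ 2 * t))) := by
    intro t ht
    have ht : (0:ℝ) < t := ht
    have h0 : 0 ≤ t ^ Δ := by positivity
    simp_rw [abs_of_pos ht, ENNReal.ofReal_mul h0]
    rw [lintegral_const_mul' _ _ ENNReal.ofReal_ne_top]
    -- translate `z = y + w` and use the Gaussian semigroup identity
    have hF := lintegral_add_right_eq_self (μ := volume) (fun z : EuclideanSpace ℝ (Fin 2) =>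
      ENNReal.ofReal (rexp (-(2 * t) * ‖v - z‖ ^ 2) * rexp (-(2 * t) * ‖w - z‖ ^ 2))) w
    beta_reduce at hF
    rw [← hF]
    have e : ∀ y : EuclideanSpace ℝ (Fin 2),
        ENNReal.ofReal (rexp (-(2 * t) * ‖v - (y + w)‖ ^ 2) * rexp (-(2 * t) * ‖w - (y + w)‖ ^ 2)) =
          ENNReal.ofReal (rexp (-(2 * t) * ‖y‖ ^ 2) * rexp (-(2 * t) * ‖v - w - y‖ ^ 2)) := by
      intro y
      rw [show w - (y + w) = -y by abel, show v - (y + w) = v - w - y by abel, norm_neg, mul_comm]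
    simp_rw [e]
    rw [rieszBalayage_lintegral_gauss_conv (by positivity) (by positivity) (v - w),
      ← ENNReal.ofReal_mul h0, ← ENNReal.ofReal_mul (by positivity)]
    congr 1
    rw [Real.rpow_sub_one ht.ne', show rexp (-(2 * t * (2 * t) / (2 * t + 2 * t)) * ‖v - w‖ ^ 2) =
      rexp (-(‖v - w‖ ^ 2 * t)) by congr 1; field_simp; ring]
    field_simp
    ring
  rw [setLIntegral_congr_fun measurableSet_Ioi h1, lintegral_const_mul' _ _ ENNReal.ofReal_ne_top,
    rieszBalayage_lintegral_rpow_mul_exp hΔ0 (by positivity : (0:ℝ) < ‖v - w‖ ^ 2),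
    ← ENNReal.ofReal_mul (by positivity)]
  congr 1
  have e : (‖v - w‖ ^ 2) ^ Δ = ‖v - w‖ ^ (2 * Δ) := by
    rw [← Real.rpow_natCast, ← Real.rpow_mul hc.le]; norm_num
  rw [one_div, Real.inv_rpow (by positivity), e, Real.rpow_neg hc.le]
  ring

/-- Bochner form of `rieszPosDef_lintegral_gaussPair`: for `v ≠ w` and `0 < Δ`,
`∫₀^∞ ∫ |t|^Δ e^{-2t|v-z|²} e^{-2t|w-z|²} dz dt = (π Γ(Δ)/4) |v-w|^{-2Δ}`. [folklore] -/
theorem rieszPosDef_integral_gaussPair {Δ : ℝ} (hΔ0 : 0 < Δ) {v w : EuclideanSpace ℝ (Fin 2)}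
    (hw : v ≠ w) :
    ∫ q, |q.1| ^ Δ * (rexp (-(2 * q.1) * ‖v - q.2‖ ^ 2) * rexp (-(2 * q.1) * ‖w - q.2‖ ^ 2))
        ∂((volume : Measure ℝ).restrict (Ioi 0)).prod volume =
      π / 4 * Real.Gamma Δ * ‖v - w‖ ^ (-(2 * Δ)) := by
  rw [integral_eq_lintegral_of_nonneg_ae (Eventually.of_forall fun q => by positivity)
    (by fun_prop (disch := positivity)), rieszPosDef_lintegral_gaussPair hΔ0 hw,
    ENNReal.toReal_ofReal (by positivity)]

/-- Integrability of `(v, w, t, z) ↦ f(v) f(w) |t|^Δ e^{-2t|v-z|²} e^{-2t|w-z|²}` on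
`(ℝ² × ℝ²) × ((0,∞) × ℝ²)` for continuous, integrable, bounded `f` and `0 < Δ < 1`: by Tonelli
its absolute integral is `(π Γ(Δ)/4) ∫∫ |f(v)| |f(w)| |v-w|^{-2Δ} < ∞`. [folklore] -/
theorem rieszPosDef_integrable_gaussPair {Δ : ℝ} (hΔ0 : 0 < Δ) (hΔ1 : Δ < 1)
    {f : EuclideanSpace ℝ (Fin 2) → ℝ} (hf : Continuous f) (hfi : Integrable f) {M : ℝ}
    (hM : ∀ x, |f x| ≤ M) :
    Integrable (uncurry fun (p : EuclideanSpace ℝ (Fin 2) × EuclideanSpace ℝ (Fin 2))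
        (q : ℝ × EuclideanSpace ℝ (Fin 2)) => f p.1 * f p.2 * (|q.1| ^ Δ *
          (rexp (-(2 * q.1) * ‖p.1 - q.2‖ ^ 2) * rexp (-(2 * q.1) * ‖p.2 - q.2‖ ^ 2))))
      (volume.prod (((volume : Measure ℝ).restrict (Ioi 0)).prod volume)) := by
  have hc : 0 < π / 4 * Real.Gamma Δ := by positivity
  have hF := rieszPosDef_integrable_prod hΔ0 hΔ1 hf hf hfi hfi hM
  refine ⟨by fun_prop (disch := positivity), ?_⟩
  rw [hasFiniteIntegral_iff_enorm, lintegral_prod _ (by fun_prop (disch := positivity))]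
  simp only [uncurry_apply_pair]
  have hG0 : ∀ (p : EuclideanSpace ℝ (Fin 2) × EuclideanSpace ℝ (Fin 2))
      (q : ℝ × EuclideanSpace ℝ (Fin 2)), 0 ≤ |q.1| ^ Δ *
        (rexp (-(2 * q.1) * ‖p.1 - q.2‖ ^ 2) * rexp (-(2 * q.1) * ‖p.2 - q.2‖ ^ 2)) :=
    fun p q => by positivity
  -- the inner integral, off the diagonal
  have hGe : ∀ p : EuclideanSpace ℝ (Fin 2) × EuclideanSpace ℝ (Fin 2), p.1 ≠ p.2 →
      ∫⁻ q, ‖f p.1 * f p.2 * (|q.1| ^ Δ *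
          (rexp (-(2 * q.1) * ‖p.1 - q.2‖ ^ 2) * rexp (-(2 * q.1) * ‖p.2 - q.2‖ ^ 2)))‖ₑ
        ∂((volume : Measure ℝ).restrict (Ioi 0)).prod volume =
      ENNReal.ofReal (π / 4 * Real.Gamma Δ) * ‖f p.1 * f p.2 * ‖p.1 - p.2‖ ^ (-(2 * Δ))‖ₑ := by
    intro p hp
    simp_rw [enorm_mul (f p.1 * f p.2), Real.enorm_eq_ofReal (hG0 _ _)]
    rw [lintegral_const_mul' _ _ enorm_ne_top, rieszPosDef_lintegral_gaussPair hΔ0 hp,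
      Real.enorm_eq_ofReal (by positivity : (0:ℝ) ≤ ‖p.1 - p.2‖ ^ (-(2 * Δ))),
      ENNReal.ofReal_mul hc.le]
    ring
  calc _ = ∫⁻ p : EuclideanSpace ℝ (Fin 2) × EuclideanSpace ℝ (Fin 2),
          ENNReal.ofReal (π / 4 * Real.Gamma Δ) * ‖f p.1 * f p.2 * ‖p.1 - p.2‖ ^ (-(2 * Δ))‖ₑ :=
        lintegral_congr_ae (rieszPosDef_ae_ne.mono hGe)
    _ = ENNReal.ofReal (π / 4 * Real.Gamma Δ) *
          ∫⁻ p : EuclideanSpace ℝ (Fin 2) × EuclideanSpace ℝ (Fin 2),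
            ‖f p.1 * f p.2 * ‖p.1 - p.2‖ ^ (-(2 * Δ))‖ₑ :=
        lintegral_const_mul' _ _ ENNReal.ofReal_ne_top
    _ < ∞ := ENNReal.mul_lt_top ENNReal.ofReal_lt_top hF.2

/-- **Positivity of the Riesz energy** on `ℝ²`: `0 ≤ ∫∫ f(v) f(w) |v-w|^{-2Δ} dv dw` for every
continuous, integrable, bounded `f` and `0 < Δ < 1` — the kernel is a superposition of Gaussian
convolution squares, `⟨f, Kf⟩ = (4/(πΓ(Δ))) ∫₀^∞ ∫ t^Δ (∫ f(x) e^{-2t|x-z|²} dx)² dz dt`.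
[cite: Landkof1972, Chapter I §4 Theorem 1.15] -/
theorem rieszPosDef_integral_nonneg {Δ : ℝ} (hΔ0 : 0 < Δ) (hΔ1 : Δ < 1)
    {f : EuclideanSpace ℝ (Fin 2) → ℝ} (hf : Continuous f) (hfi : Integrable f) {M : ℝ}
    (hM : ∀ x, |f x| ≤ M) : 0 ≤ ∫ p : EuclideanSpace ℝ (Fin 2) × EuclideanSpace ℝ (Fin 2),
      f p.1 * f p.2 * ‖p.1 - p.2‖ ^ (-(2 * Δ)) := by
  have hc : 0 < π / 4 * Real.Gamma Δ := by positivity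
  -- (1) insert the Gaussian representation of the kernel
  have h1 : ∫ p : EuclideanSpace ℝ (Fin 2) × EuclideanSpace ℝ (Fin 2),
      f p.1 * f p.2 * ‖p.1 - p.2‖ ^ (-(2 * Δ)) =
        ∫ p : EuclideanSpace ℝ (Fin 2) × EuclideanSpace ℝ (Fin 2), (π / 4 * Real.Gamma Δ)⁻¹ *
          ∫ q, f p.1 * f p.2 * (|q.1| ^ Δ *
            (rexp (-(2 * q.1) * ‖p.1 - q.2‖ ^ 2) * rexp (-(2 * q.1) * ‖p.2 - q.2‖ ^ 2)))
          ∂((volume : Measure ℝ).restrict (Ioi 0)).prod volume := by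
    refine integral_congr_ae (rieszPosDef_ae_ne.mono fun p hp => ?_)
    beta_reduce
    rw [integral_const_mul, rieszPosDef_integral_gaussPair hΔ0 hp]
    field_simp
  -- (2) for fixed `(t, z)` the `(v, w)`-integral is a square
  have h2 : ∀ q : ℝ × EuclideanSpace ℝ (Fin 2),
      ∫ p : EuclideanSpace ℝ (Fin 2) × EuclideanSpace ℝ (Fin 2), f p.1 * f p.2 * (|q.1| ^ Δ *
          (rexp (-(2 * q.1) * ‖p.1 - q.2‖ ^ 2) * rexp (-(2 * q.1) * ‖p.2 - q.2‖ ^ 2))) =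
        |q.1| ^ Δ * (∫ x, f x * rexp (-(2 * q.1) * ‖x - q.2‖ ^ 2)) ^ 2 := by
    intro q
    have e : (fun p : EuclideanSpace ℝ (Fin 2) × EuclideanSpace ℝ (Fin 2) => f p.1 * f p.2 *
        (|q.1| ^ Δ * (rexp (-(2 * q.1) * ‖p.1 - q.2‖ ^ 2) * rexp (-(2 * q.1) * ‖p.2 - q.2‖ ^ 2)))) =
        fun p => |q.1| ^ Δ * ((f p.1 * rexp (-(2 * q.1) * ‖p.1 - q.2‖ ^ 2)) *
          (f p.2 * rexp (-(2 * q.1) * ‖p.2 - q.2‖ ^ 2))) := by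
      ext p; ring
    rw [e, integral_const_mul, Measure.volume_eq_prod, integral_prod_mul (μ := volume)
      (ν := volume) (fun x => f x * rexp (-(2 * q.1) * ‖x - q.2‖ ^ 2))
      (fun x => f x * rexp (-(2 * q.1) * ‖x - q.2‖ ^ 2)), sq]
  rw [h1, integral_const_mul,
    integral_integral_swap (rieszPosDef_integrable_gaussPair hΔ0 hΔ1 hf hfi hM)]
  simp_rw [h2]
  exact mul_nonneg (inv_nonneg.2 hc.le) (integral_nonneg fun q => by positivity)

/-- **Stub C1** (`stub_rieszKernelPosDef`): positive semi-definiteness of the Riesz kernel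
`K(v, w) = |v - w|^{-2Δ}` on `ℝ²` for `1/2 ≤ Δ < 1`, in completed-square form
`2⟨φ, Kψ⟩ ≤ ⟨φ, Kφ⟩ + ⟨ψ, Kψ⟩` (iterated Bochner integrals) for a compactly supported continuous
`φ` and a continuous `ψ` with `|ψ(w)| ≤ C (1+|w|²)^{Δ-2}`: expand `0 ≤ ⟨φ-ψ, K(φ-ψ)⟩`
(`rieszPosDef_integral_nonneg`) by bilinearity and the symmetry `⟨ψ, Kφ⟩ = ⟨φ, Kψ⟩`, all double
integrals being absolutely convergent (`rieszPosDef_integrable_prod`).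
[cite: Landkof1972, Chapter I §4 Theorem 1.15] -/
theorem stub_rieszKernelPosDef :
    ∀ Δ : ℝ, 1 / 2 ≤ Δ → Δ < 1 → ∀ (φ : EuclideanSpace ℝ (Fin 2) → ℝ) (R : ℕ), Continuous φ →
      (∀ v : EuclideanSpace ℝ (Fin 2), (R : ℝ) ≤ ‖v‖ → φ v = 0) →
      ∀ (ψ : EuclideanSpace ℝ (Fin 2) → ℝ) (C : ℝ), Continuous ψ →
      (∀ w : EuclideanSpace ℝ (Fin 2), |ψ w| ≤ C * (1 + ‖w‖ ^ 2) ^ (Δ - 2)) →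
      2 * ∫ v : EuclideanSpace ℝ (Fin 2), ∫ w : EuclideanSpace ℝ (Fin 2),
          φ v * ψ w * ‖v - w‖ ^ (-(2 * Δ)) ≤
        (∫ v : EuclideanSpace ℝ (Fin 2), ∫ w : EuclideanSpace ℝ (Fin 2),
            φ v * φ w * ‖v - w‖ ^ (-(2 * Δ))) +
          ∫ v : EuclideanSpace ℝ (Fin 2), ∫ w : EuclideanSpace ℝ (Fin 2),
            ψ v * ψ w * ‖v - w‖ ^ (-(2 * Δ)) := by
  intro Δ hΔ hΔ1 φ R hφc hφR ψ C hψc hψC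
  have hΔ0 : 0 < Δ := by linarith
  -- `φ` is integrable and bounded (compact support); `ψ` is bounded by `C` and integrable
  have hφs : HasCompactSupport φ := HasCompactSupport.intro (isCompact_closedBall 0 (R : ℝ))
    fun v hv => hφR v (le_of_lt (by simpa using hv))
  have hφi : Integrable φ := hφc.integrable_of_hasCompactSupport hφs
  obtain ⟨A, hA⟩ := hφc.bounded_above_of_compact_support hφs
  have hφb : ∀ x, |φ x| ≤ A := fun x => by simpa [Real.norm_eq_abs] using hA x
  have hC : 0 ≤ C := by simpa using (abs_nonneg _).trans (hψC 0)
  have hψb : ∀ w, |ψ w| ≤ C := fun w => (hψC w).trans (mul_le_of_le_one_right hC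
    (Real.rpow_le_one_of_one_le_of_nonpos (le_add_of_nonneg_right (sq_nonneg _)) (by linarith)))
  have hψi : Integrable ψ := by
    have h2 : (Module.finrank ℝ (EuclideanSpace ℝ (Fin 2)) : ℝ) < 4 - 2 * Δ := by
      rw [finrank_euclideanSpace_fin]; push_cast; linarith
    refine ((integrable_rpow_neg_one_add_norm_sq (μ := volume) h2).const_mul C).mono'
      hψc.aestronglyMeasurable (Eventually.of_forall fun w => ?_)
    rw [Real.norm_eq_abs, show -(4 - 2 * Δ) / 2 = Δ - 2 by ring]
    exact hψC w
  -- absolute convergence of the four energies; positivity of the energy of `f = φ - ψ`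
  have Iφφ := rieszPosDef_integrable_prod hΔ0 hΔ1 hφc hφc hφi hφi hφb
  have Iφψ := rieszPosDef_integrable_prod hΔ0 hΔ1 hφc hψc hφi hψi hψb
  have Iψφ := rieszPosDef_integrable_prod hΔ0 hΔ1 hψc hφc hψi hφi hφb
  have Iψψ := rieszPosDef_integrable_prod hΔ0 hΔ1 hψc hψc hψi hψi hψb
  have key : 0 ≤ ∫ p : EuclideanSpace ℝ (Fin 2) × EuclideanSpace ℝ (Fin 2),
      (φ p.1 - ψ p.1) * (φ p.2 - ψ p.2) * ‖p.1 - p.2‖ ^ (-(2 * Δ)) :=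
    rieszPosDef_integral_nonneg hΔ0 hΔ1 (hφc.sub hψc) (hφi.sub hψi) (M := A + C)
      fun x => (abs_sub _ _).trans (add_le_add (hφb x) (hψb x))
  -- bilinearity and the symmetry of the kernel
  have e1 : (fun p : EuclideanSpace ℝ (Fin 2) × EuclideanSpace ℝ (Fin 2) =>
      (φ p.1 - ψ p.1) * (φ p.2 - ψ p.2) * ‖p.1 - p.2‖ ^ (-(2 * Δ))) = fun p =>
        φ p.1 * φ p.2 * ‖p.1 - p.2‖ ^ (-(2 * Δ)) - φ p.1 * ψ p.2 * ‖p.1 - p.2‖ ^ (-(2 * Δ)) -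
          ψ p.1 * φ p.2 * ‖p.1 - p.2‖ ^ (-(2 * Δ)) + ψ p.1 * ψ p.2 * ‖p.1 - p.2‖ ^ (-(2 * Δ)) := by
    ext p; ring
  rw [e1, integral_add ((Iφφ.sub' Iφψ).sub' Iψφ) Iψψ, integral_sub (Iφφ.sub' Iφψ) Iψφ,
    integral_sub Iφφ Iφψ] at key
  have s : ∫ p : EuclideanSpace ℝ (Fin 2) × EuclideanSpace ℝ (Fin 2),
      ψ p.1 * φ p.2 * ‖p.1 - p.2‖ ^ (-(2 * Δ)) = ∫ p : EuclideanSpace ℝ (Fin 2) ×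
        EuclideanSpace ℝ (Fin 2), φ p.1 * ψ p.2 * ‖p.1 - p.2‖ ^ (-(2 * Δ)) := by
    rw [Measure.volume_eq_prod, ← integral_prod_swap]
    refine integral_congr_ae (Eventually.of_forall fun p => ?_)
    simp only [Prod.fst_swap, Prod.snd_swap]
    rw [norm_sub_rev]; ring
  -- the iterated integrals are the product integrals
  have r1 : (∫ v, ∫ w, φ v * ψ w * ‖v - w‖ ^ (-(2 * Δ))) = ∫ p : EuclideanSpace ℝ (Fin 2) ×
      EuclideanSpace ℝ (Fin 2), φ p.1 * ψ p.2 * ‖p.1 - p.2‖ ^ (-(2 * Δ)) :=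
    (integral_prod _ Iφψ).symm
  have r2 : (∫ v, ∫ w, φ v * φ w * ‖v - w‖ ^ (-(2 * Δ))) = ∫ p : EuclideanSpace ℝ (Fin 2) ×
      EuclideanSpace ℝ (Fin 2), φ p.1 * φ p.2 * ‖p.1 - p.2‖ ^ (-(2 * Δ)) :=
    (integral_prod _ Iφφ).symm
  have r3 : (∫ v, ∫ w, ψ v * ψ w * ‖v - w‖ ^ (-(2 * Δ))) = ∫ p : EuclideanSpace ℝ (Fin 2) ×
      EuclideanSpace ℝ (Fin 2), ψ p.1 * ψ p.2 * ‖p.1 - p.2‖ ^ (-(2 * Δ)) :=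
    (integral_prod _ Iψψ).symm
  rw [r1, r2, r3]
  linarith [key, s]

end Summit.CriticalPhenomena.Ising3DConformalLimit.Cruxes.GaussianLimitNotScreened.SingleLayerLinearRegression
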